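import Summits.ResolutionOfSingularities.ResolutionOfSingularities.Theorems.WeightedInvariantELadderTwoCompatible
import Summits.ResolutionOfSingularities.ResolutionOfSingularities.Theorems.WeightedInvariantELadderTwoIotaTransport
import Summits.ResolutionOfSingularities.ResolutionOfSingularities.Theorems.WeightedInvariantHypersurfaceLocalGameEFT4SDimLEDoor
import HarnessLib

/-!
# E2 tier, (o59-loc) OFF-CENTRE branch: the order-theory lines on `genSing₂ ∖ maxLocus₂` and the ring-level bound `ι T g ≤ ι A f`

[OURS · L1 W4.3 · door `HypersurfaceCentreConstruction` (stmt-ResolutionOfSingularities-19897) · E2 tier · registrar res-L1-w43-plan-1 ORDER (o58d)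
2026-08-27T16:23:33Z (i) + (ii) (statements the registrar's, names mine) · typed by res-D-pv-056 AS res-L1-w43-stub-5.  Def-free; kernel algebra +
two order-theory lines; `--supports stmt-ResolutionOfSingularities-19897 --as helper`.  Not a statement of [Hironaka2017]; candidates only.]

* (i) STAGE ORDER LINES (ns `…Theorems.ELadderOne.Stage`): `iotaAt_lt_mu₂_of_not_mem_maxLocus₂` — a point of `genSing₂` outside `maxLocus₂` has
  `ι_η < mu₂` (`iotaAt_le_mu₂` + `mem_maxLocus₂_iff`); `…_of_not_mem_closure` (via `subset_closure`); `…_of_not_mem_support` — for a canonical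
  `e = 2` centre `R` (`IsCanonicalCentre₂.support_eq`), `η ∈ genSing₂ ∖ supp R ⇒ ι_η < mu₂`.
* (ii) RING LEVEL (ns `…LocalEngine.E2OffCentre`): `iota_le_of_offCentre_model` — under (c6) `IotaIsoInvariant`, (c-u) `IotaUnitInvariant` and
  (c10)≤3 `IotaTorusFactorMonotoneLE 3 p ι`: for `A` regular local, essentially of finite type over a perfect field of characteristic `p`,
  `ringKrullDim A ≤ 3`, `f : A`, a prime `𝔮 ⊂ A[X]` over `𝔪_A`, a ring isomorphism `e : A[X]_𝔮 ≃+* T` and `Associated (e (C f /1)) g`: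
  `ι T g ≤ ι A f` (= `IotaTransport.iota_eq_of_ringEquiv_of_associated` p547284 + the text of `IotaTorusFactorMonotoneLE`, …EFT4SDimLEDoor l.85).
* (iii) the STAGE-LEVEL reading from `Stage.SuccOffCentreAt` (…ELadderTwoCompatible p546537) is NOT in this file (next piece).
-/

noncomputable section

open CategoryTheory AlgebraicGeometry TopologicalSpace IsLocalRing
open Literature.AlgebraicGeometry.Resolution
open Summit.ResolutionOfSingularities.ResolutionOfSingularities.Theorems
open Summit.ResolutionOfSingularities.ResolutionOfSingularities.Cruxes.HypersurfaceCentreConstruction.LocalEngine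

set_option linter.dupNamespace false -- mandated namespace of this single-conjunct summit

/-! ## (i) Order lines on the stage -/

namespace Summit.ResolutionOfSingularities.ResolutionOfSingularities.Theorems.ELadderOne.Stage

variable {k : Type} [Field k]
variable (ι : (R : Type) → [CommRing R] → R → Ordinal.{0}) (J : (R : Type) → [CommRing R] → R → ℕ → Ideal R)

/-- A point of `genSing₂` outside the maximum locus has `ι_η < mu₂`. [folklore] -/
theorem iotaAt_lt_mu₂_of_not_mem_maxLocus₂ (S : Stage k) {η : S.Y} (hη : η ∈ S.genSing₂) (hn : η ∉ S.maxLocus₂ ι) :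
    iotaAt ι S.i.ker η < S.mu₂ ι :=
  lt_of_le_of_ne (S.iotaAt_le_mu₂ ι hη) fun h => hn ((S.mem_maxLocus₂_iff ι η).mpr ⟨hη, h⟩)

/-- The closure form: a point of `genSing₂` outside the CLOSURE of the maximum locus has `ι_η < mu₂`. [folklore] -/
theorem iotaAt_lt_mu₂_of_not_mem_closure (S : Stage k) {η : S.Y} (hη : η ∈ S.genSing₂) (hn : η ∉ closure (S.maxLocus₂ ι)) :
    iotaAt ι S.i.ker η < S.mu₂ ι :=
  S.iotaAt_lt_mu₂_of_not_mem_maxLocus₂ ι hη fun h => hn (subset_closure h)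

/-- For a canonical `e = 2` centre `R` (`supp R = closure maxLocus₂`): a point of `genSing₂` off `supp R` has `ι_η < mu₂`. [folklore] -/
theorem iotaAt_lt_mu₂_of_not_mem_support (S : Stage k) {R : ReesAlgebraData S.Y} (hR : S.IsCanonicalCentre₂ ι J R) {η : S.Y}
    (hη : η ∈ S.genSing₂) (hn : η ∉ R.support) : iotaAt ι S.i.ker η < S.mu₂ ι := by
  refine S.iotaAt_lt_mu₂_of_not_mem_closure ι hη ?_
  rw [← hR.support_eq]
  exact hn

end Summit.ResolutionOfSingularities.ResolutionOfSingularities.Theorems.ELadderOne.Stage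

/-! ## (ii) The ring-level bound through the torus-factor model `A[X]_𝔮` -/

namespace Summit.ResolutionOfSingularities.ResolutionOfSingularities.Cruxes.HypersurfaceCentreConstruction.LocalEngine

namespace E2OffCentre

/-- **(o58d) (ii) OFF-CENTRE BOUND AT THE RING LEVEL.**  Under (c6), (c-u) and (c10)≤3 `IotaTorusFactorMonotoneLE 3 p ι`: for `A` regular
local, essentially of finite type over a perfect field of characteristic `p`, `ringKrullDim A ≤ 3`, `f : A`, a prime `𝔮` of `A[X]` lying over
`𝔪_A`, a ring isomorphism `e : A[X]_𝔮 ≃+* T` and `Associated (e (C f / 1)) g`: `ι T g ≤ ι A f`. [folklore] -/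
theorem iota_le_of_offCentre_model {p : ℕ} {ι : (R : Type) → [CommRing R] → R → Ordinal.{0}}
    (hiso : IotaIsoInvariant ι) (hunit : IotaUnitInvariant ι) (hc10 : IotaTorusFactorMonotoneLE 3 p ι)
    (k₀ : Type) [Field k₀] [CharP k₀ p] [PerfectField k₀]
    {A T : Type} [CommRing A] [CommRing T] [Algebra k₀ A] [Algebra.EssFiniteType k₀ A] [IsRegularLocalRing A]
    (hdim : ringKrullDim A ≤ 3) (f : A) (𝔮 : Ideal (Polynomial A)) [𝔮.IsPrime]
    (h𝔮 : 𝔮.comap (Polynomial.C : A →+* Polynomial A) = maximalIdeal A)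
    (e : Localization.AtPrime 𝔮 ≃+* T) {g : T}
    (h : Associated (e (algebraMap (Polynomial A) (Localization.AtPrime 𝔮) (Polynomial.C f))) g) :
    ι T g ≤ ι A f := by
  have heq : ι T g = ι (Localization.AtPrime 𝔮) (algebraMap (Polynomial A) (Localization.AtPrime 𝔮) (Polynomial.C f)) :=
    @IotaTransport.iota_eq_of_ringEquiv_of_associated ι hiso hunit (Localization.AtPrime 𝔮) T (_) (_) e _ _ h
  rw [heq]
  exact hc10 k₀ A f 𝔮 hdim h𝔮

end E2OffCentre

end Summit.ResolutionOfSingularities.ResolutionOfSingularities.Cruxes.HypersurfaceCentreConstruction.LocalEngine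

/-! ## (iii) rev 2 (APPEND-ONLY): the STAGE-LEVEL reading from `Stage.SuccOffCentreAt` (registrar ORDER (o58d)(iii) 2026-08-27T16:23:33Z;
the k₀-algebra / essentially-finite-type / regular-local-ring structure and the dimension bound of the stalk `𝒪_{Y, π η′}` are HYPOTHESES here —
U6 of E2-CENSUS v0 §6 supplies them on unit charts; nothing geometric is proved in this file) -/

namespace Summit.ResolutionOfSingularities.ResolutionOfSingularities.Theorems.ELadderOne.Stage

variable {k : Type} [Field k]

/-- **(o58d)(iii) OFF-CENTRE BOUND AT THE STAGE LEVEL.**  Under (c6), (c-u), (c10)≤3: if the successor point `η'` reads through the torus-factor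
local model (`S.SuccOffCentreAt S' π η'`, …ELadderTwoCompatible) and the stalk `𝒪_{Y, π η'}` is a regular local `k₀`-algebra essentially of
finite type of Krull dimension `≤ 3` (`k₀` perfect of characteristic `p`), then `ι_{η'} ≤ ι_{π η'}`. [folklore] -/
theorem iotaAt_le_of_succOffCentreAt {p : ℕ} (ι : (R : Type) → [CommRing R] → R → Ordinal.{0})
    (hiso : IotaIsoInvariant ι) (hunit : IotaUnitInvariant ι) (hc10 : IotaTorusFactorMonotoneLE 3 p ι)
    (k₀ : Type) [Field k₀] [CharP k₀ p] [PerfectField k₀]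
    (S S' : Stage k) (π : S'.Y ⟶ S.Y) (η' : S'.Y)
    [Algebra k₀ (S.Y.presheaf.stalk (π.base η'))] [Algebra.EssFiniteType k₀ (S.Y.presheaf.stalk (π.base η'))]
    [IsRegularLocalRing (S.Y.presheaf.stalk (π.base η'))]
    (hdim : ringKrullDim (S.Y.presheaf.stalk (π.base η')) ≤ 3) (h : S.SuccOffCentreAt S' π η') :
    iotaAt ι S'.i.ker η' ≤ iotaAt ι S.i.ker (π.base η') := by
  obtain ⟨𝔮, h𝔮, hcomap, e, -, hassoc⟩ := h
  haveI : 𝔮.IsPrime := h𝔮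
  exact E2OffCentre.iota_le_of_offCentre_model hiso hunit hc10 k₀ hdim _ 𝔮 hcomap e hassoc

/-- **(o58d) OFF-CENTRE, assembled:** for a canonical `e = 2` centre `R` and a COMPATIBLE successor (`S.SuccCompatible ι R S' π`), a read point
`η' ∈ genSing₂'` lying OFF `supp R` has `ι_{η'} < mu₂` — (iii) `ι_{η'} ≤ ι_{π η'}` and (i) `ι_{π η'} < mu₂` (`π η' ∈ genSing₂ ∖ supp R`); same
hypotheses on the stalk `𝒪_{Y, π η'}` as in `iotaAt_le_of_succOffCentreAt`. [folklore] -/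
theorem iotaAt_lt_mu₂_of_succCompatible_offCentre {p : ℕ} (ι : (R : Type) → [CommRing R] → R → Ordinal.{0})
    (J : (R : Type) → [CommRing R] → R → ℕ → Ideal R)
    (hiso : IotaIsoInvariant ι) (hunit : IotaUnitInvariant ι) (hc10 : IotaTorusFactorMonotoneLE 3 p ι)
    (k₀ : Type) [Field k₀] [CharP k₀ p] [PerfectField k₀]
    (S S' : Stage k) {R : ReesAlgebraData S.Y} (π : S'.Y ⟶ S.Y) (hR : S.IsCanonicalCentre₂ ι J R) (hc : S.SuccCompatible ι R S' π)
    (η' : S'.Y) [Algebra k₀ (S.Y.presheaf.stalk (π.base η'))] [Algebra.EssFiniteType k₀ (S.Y.presheaf.stalk (π.base η'))]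
    [IsRegularLocalRing (S.Y.presheaf.stalk (π.base η'))]
    (hdim : ringKrullDim (S.Y.presheaf.stalk (π.base η')) ≤ 3) (hη' : η' ∈ S'.genSing₂) (hn : π.base η' ∉ R.support) :
    iotaAt ι S'.i.ker η' < S.mu₂ ι := by
  obtain ⟨hy, hoff⟩ := hc.offCentre η' hη' hn
  exact lt_of_le_of_lt (iotaAt_le_of_succOffCentreAt ι hiso hunit hc10 k₀ S S' π η' hdim hoff)
    (S.iotaAt_lt_mu₂_of_not_mem_support ι J hR hy hn)

end Summit.ResolutionOfSingularities.ResolutionOfSingularities.Theorems.ELadderOne.Stage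

end
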